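import Literature.Analysis.UnboundedOperators.LinearizedBoltzmannAction
import HarnessLib

/-!
# The kernel part of the linearised hard-sphere operator acts by its integral formula on `L²(M dv)`

Sibling proof file of `LinearizedBoltzmannAction.lean`. There, Grad's kernel part
`K = K₂' + K₂'' - K₁` of the linearised hard-sphere operator `L = -ν + K` (the bounded operator
`gainLossOp hE` on `L²(M dv)`, `LinearizedBoltzmannOperator`) is shown to act on classes of
*temperate* functions by the absolutely convergent integral
`(K g)(v) = ∫∫ ((v - v_*)·ω)₊ (g(v') + g(v_*') - g(v_*)) dω dM(v_*)` (`gainLossOp_toLp`). Here we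
extend this to **every** `f ∈ L²(M dv)`:

* `linearizedKernelForm_eq_integral_of_memLp` — Fubini for `⟪h, K g⟫_M` with `g, h ∈ L²(M dv)`
  (the three kernel forms are absolutely convergent, `LinearizedBoltzmannGainForms`);
* `lintegral_enorm_kernelAction_le` / `integrable_kernelAction_of_memLp` — the iterated integral
  `v ↦ ∫∫ B (g' + g_*' - g_*) dω dM_*` is in `L¹(M dv)` with
  `∫ |·| dM ≤ C_K ‖1‖ ‖g‖` for `g ∈ L²(M dv)`;
* `coeFn_gainLossOp_ae_eq_kernelAction` — **`K f = ∫∫ B (f' + f_*' - f_*) dω dM_*` almost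
  everywhere**, for every `f ∈ L²(M dv)` (test against indicators).

This is the class-level half of the pointwise (everywhere) description of `K` needed for the
continuous representative of `L⁻¹ g` in the Chapman–Enskog theory (CIP 1994 §7.2, Thm 7.2.3 and
(2.14)–(2.16)). General dimension `d ≥ 2`; no new definitions.
-/

open MeasureTheory Metric Real Set Filter Topology ProbabilityTheory Module
open scoped InnerProductSpace ENNReal

namespace Literature.Analysis.UnboundedOperators

noncomputable section

open Literature.MathematicalPhysics.KineticTheory (collide sphereMeasure hardSphereKernel)
open Literature.Analysis.FluidPDE

variable {E : Type*} [NormedAddCommGroup E] [InnerProductSpace ℝ E] [FiniteDimensional ℝ E]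
  [MeasurableSpace E] [BorelSpace E]

/-! ### Measurability of the kernel integrand for measurable `g` -/

/-- The kernel integrand `B (g(v') + g(v_*') - g(v_*))` of a measurable `g` is measurable on
`E × E × S^{d-1}`. [folklore] -/
theorem measurable_kernelIntegrand {g : E → ℝ} (hg : Measurable g) :
    Measurable fun q : (E × E) × sphere (0 : E) 1 => hardSphereKernel q.1 q.2 *
      (g (collide q.2 q.1).1 + g (collide q.2 q.1).2 - g q.1.2) := by
  have hB : Continuous fun q : (E × E) × sphere (0 : E) 1 => hardSphereKernel q.1 q.2 := by
    unfold hardSphereKernel; fun_prop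
  have hc1 : Continuous fun q : (E × E) × sphere (0 : E) 1 => (collide q.2 q.1).1 := by
    unfold collide; fun_prop
  have hc2 : Continuous fun q : (E × E) × sphere (0 : E) 1 => (collide q.2 q.1).2 := by
    unfold collide; fun_prop
  exact hB.measurable.mul (((hg.comp hc1.measurable).add (hg.comp hc2.measurable)).sub
    (hg.comp (measurable_snd.comp measurable_fst)))

/-- The iterated kernel integral `v ↦ ∫∫ B (g' + g_*' - g_*) dω dM_*` of a measurable `g` is
strongly measurable. [folklore] -/
theorem stronglyMeasurable_kernelAction_of_measurable {g : E → ℝ} (hg : Measurable g) :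
    StronglyMeasurable fun v : E => ∫ w, ∫ ω, hardSphereKernel (v, w) ω *
      (g (collide ω (v, w)).1 + g (collide ω (v, w)).2 - g w) ∂sphereMeasure ∂stdGaussian E := by
  have h1 : StronglyMeasurable fun p : E × E => ∫ ω, hardSphereKernel p ω *
      (g (collide ω p).1 + g (collide ω p).2 - g p.2) ∂(sphereMeasure : Measure (sphere (0 : E) 1)) :=
    (measurable_kernelIntegrand hg).stronglyMeasurable.integral_prod_right'
  exact h1.integral_prod_right' (ν := stdGaussian E)

/-! ### Fubini for `⟪h, K g⟫` with `g ∈ L²(M dv)` -/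

/-- **Fubini for `⟪h, K g⟫` on `L²(M dv)`**: for `g, h ∈ L²(M dv)`,
`⟪h, K g⟫_M = ∫ h(v) (∫∫ B (g(v') + g(v_*') - g(v_*)) dω dM(v_*)) dM(v)` (the three kernel forms are
absolutely convergent; compare `linearizedKernelForm_eq_integral` for temperate `g`). [folklore] -/
theorem linearizedKernelForm_eq_integral_of_memLp (hE : 2 ≤ finrank ℝ E) {g h : E → ℝ}
    (hg : MemLp g 2 (stdGaussian E)) (hh : MemLp h 2 (stdGaussian E)) :
    linearizedKernelForm h g = ∫ v, h v * (∫ w, ∫ ω, hardSphereKernel (v, w) ω *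
      (g (collide ω (v, w)).1 + g (collide ω (v, w)).2 - g w) ∂sphereMeasure ∂stdGaussian E)
      ∂stdGaussian E := by
  have i1 := (integrable_and_abs_kernelForm_le quasiMeasurePreserving_gainVelFst
    gainFstRowConst_ne_top hh hg (lintegral_enorm_kernelForm_gainVelFst_le hh.1 hg.1)).1
  have i2 := (integrable_and_abs_kernelForm_le quasiMeasurePreserving_gainVelSnd
    (gainSndRowConst_ne_top hE) hh hg (lintegral_enorm_kernelForm_gainVelSnd_le hE hh.1 hg.1)).1
  have i3 := (integrable_and_abs_kernelForm_le quasiMeasurePreserving_lossVel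
    lossRowConst_ne_top hh hg (lintegral_enorm_kernelForm_lossVel_le hh.1 hg.1)).1
  set Kint : (E × E) × sphere (0 : E) 1 → ℝ := fun q => collisionDensity q *
    (h q.1.1 * (g (collide q.2 q.1).1 + g (collide q.2 q.1).2 - g q.1.2)) with hKint
  have hK : Integrable Kint (((volume : Measure E).prod volume).prod sphereMeasure) := by
    refine ((i1.add i2).sub i3).congr (Eventually.of_forall fun q => ?_)
    simp only [hKint, Pi.add_apply, Pi.sub_apply, gainVelFst_apply, gainVelSnd_apply, lossVel_apply]
    ring
  have hsum : linearizedKernelForm h g =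
      ∫ q, Kint q ∂(((volume : Measure E).prod volume).prod sphereMeasure) := by
    have hadd : Integrable (fun q => collisionDensity q * (h q.1.1 * g (gainVelFst q)) +
        collisionDensity q * (h q.1.1 * g (gainVelSnd q)))
        (((volume : Measure E).prod volume).prod sphereMeasure) := i1.add i2
    simp only [linearizedKernelForm, kernelForm]
    rw [← integral_add i1 i2, ← integral_sub hadd i3]
    refine integral_congr_ae (Eventually.of_forall fun q => ?_)
    simp only [hKint, gainVelFst_apply, gainVelSnd_apply, lossVel_apply]
    ring
  rw [hsum, integral_prod _ hK, integral_prod _ hK.integral_prod_left,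
    integral_stdGaussian_eq_integral_mul_globalMaxwellian]
  refine integral_congr_ae (Eventually.of_forall fun v => ?_)
  dsimp only
  rw [integral_stdGaussian_eq_integral_mul_globalMaxwellian, ← integral_const_mul,
    ← integral_const_mul]
  refine integral_congr_ae (Eventually.of_forall fun w => ?_)
  dsimp only
  rw [← integral_const_mul, ← integral_const_mul, ← integral_const_mul]
  refine integral_congr_ae (Eventually.of_forall fun ω => ?_)
  simp only [hKint, collisionDensity]
  ring

/-! ### The kernel action of an `L²(M dv)` function is in `L¹(M dv)` -/

/-- **`L¹(M dv)` bound on the kernel action**: for measurable `g ∈ L²(M dv)`,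
`∫ |∫∫ B (g' + g_*' - g_*) dω dM_*| dM ≤ C_K ‖1‖_{L²(M)} ‖g‖_{L²(M)}` (Tonelli and the three
absolute kernel-form bounds of `LinearizedBoltzmannGainForms` with `h = 1`). [folklore] -/
theorem lintegral_enorm_kernelAction_le (hE : 2 ≤ finrank ℝ E) {g : E → ℝ}
    (hg : MemLp g 2 (stdGaussian E)) (hgm : Measurable g) :
    ∫⁻ v, ‖∫ w, ∫ ω, hardSphereKernel (v, w) ω *
        (g (collide ω (v, w)).1 + g (collide ω (v, w)).2 - g w) ∂sphereMeasure ∂stdGaussian E‖ₑ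
        ∂stdGaussian E ≤
      kernelConst hE * eLpNorm (fun _ : E => (1 : ℝ)) 2 (stdGaussian E) * eLpNorm g 2 (stdGaussian E) := by
  have h1 : AEStronglyMeasurable (fun _ : E => (1 : ℝ)) (stdGaussian E) := aestronglyMeasurable_const
  have hM : Measurable fun v : E => ENNReal.ofReal (globalMaxwellian v) :=
    continuous_globalMaxwellian.measurable.ennreal_ofReal
  have hBc : Continuous fun q : (E × E) × sphere (0 : E) 1 => hardSphereKernel q.1 q.2 := by
    unfold hardSphereKernel; fun_prop
  have hc1 : Measurable fun q : (E × E) × sphere (0 : E) 1 => (collide q.2 q.1).1 := by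
    have : Continuous fun q : (E × E) × sphere (0 : E) 1 => (collide q.2 q.1).1 := by
      unfold collide; fun_prop
    exact this.measurable
  have hc2 : Measurable fun q : (E × E) × sphere (0 : E) 1 => (collide q.2 q.1).2 := by
    have : Continuous fun q : (E × E) × sphere (0 : E) 1 => (collide q.2 q.1).2 := by
      unfold collide; fun_prop
    exact this.measurable
  -- the dominating integrand `G = B (|g(v')| + |g(v_*')| + |g(v_*)|)` on `E × E × S`
  set G : (E × E) × sphere (0 : E) 1 → ℝ≥0∞ := fun q => ENNReal.ofReal (hardSphereKernel q.1 q.2) *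
    (‖g (collide q.2 q.1).1‖ₑ + ‖g (collide q.2 q.1).2‖ₑ + ‖g q.1.2‖ₑ) with hG
  have hGm : Measurable G :=
    hBc.measurable.ennreal_ofReal.mul (((hgm.comp hc1).enorm.add (hgm.comp hc2).enorm).add
      (hgm.comp (measurable_snd.comp measurable_fst)).enorm)
  -- Step 1: `‖kernel action (v)‖ₑ ≤ ∫∫ G`
  have hstep1 : ∀ v : E, ‖∫ w, ∫ ω, hardSphereKernel (v, w) ω *
      (g (collide ω (v, w)).1 + g (collide ω (v, w)).2 - g w) ∂sphereMeasure ∂stdGaussian E‖ₑ ≤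
      ∫⁻ w, ∫⁻ ω, G ((v, w), ω) ∂sphereMeasure ∂stdGaussian E := by
    intro v
    refine (enorm_integral_le_lintegral_enorm _).trans (lintegral_mono fun w => ?_)
    refine (enorm_integral_le_lintegral_enorm _).trans (lintegral_mono fun ω => ?_)
    simp only [hG]
    rw [enorm_mul, Real.enorm_eq_ofReal (show 0 ≤ hardSphereKernel (v, w) ω from le_max_right _ _)]
    refine mul_le_mul' le_rfl ?_
    exact (enorm_sub_le).trans (add_le_add (enorm_add_le _ _) le_rfl)
  -- Step 2: Tonelli, `∫∫∫ M M_* G = ∫ over vol × vol × σ`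
  have hGv : ∀ v, Measurable fun p : E × sphere (0 : E) 1 => G ((v, p.1), p.2) := fun v =>
    hGm.comp (by fun_prop)
  have hF3 : Measurable fun q : (E × E) × sphere (0 : E) 1 =>
      ENNReal.ofReal (globalMaxwellian q.1.1) * ENNReal.ofReal (globalMaxwellian q.1.2) * G q :=
    ((hM.comp (measurable_fst.comp measurable_fst)).mul (hM.comp (measurable_snd.comp measurable_fst))).mul hGm
  have hstep2 : ∫⁻ v, ∫⁻ w, ∫⁻ ω, G ((v, w), ω) ∂sphereMeasure ∂stdGaussian E ∂stdGaussian E =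
      ∫⁻ q, ENNReal.ofReal (globalMaxwellian q.1.1) * ENNReal.ofReal (globalMaxwellian q.1.2) * G q
        ∂(((volume : Measure E).prod volume).prod sphereMeasure) := by
    -- the right side as an iterated integral
    rw [lintegral_prod _ hF3.aemeasurable, lintegral_prod _ hF3.lintegral_prod_right'.aemeasurable]
    -- the left side: densities `M(v)`, `M(w)`
    have hinner : ∀ v, ∫⁻ w, ∫⁻ ω, G ((v, w), ω) ∂sphereMeasure ∂stdGaussian E =
        ∫⁻ w, ENNReal.ofReal (globalMaxwellian w) * ∫⁻ ω, G ((v, w), ω) ∂sphereMeasure := by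
      intro v
      rw [stdGaussian_eq_withDensity_globalMaxwellian_holds,
        lintegral_withDensity_eq_lintegral_mul _ hM (hGv v).lintegral_prod_right']
      rfl
    simp_rw [hinner]
    have hmeas2 : Measurable fun v : E => ∫⁻ w, ENNReal.ofReal (globalMaxwellian w) *
        ∫⁻ ω, G ((v, w), ω) ∂(sphereMeasure : Measure (sphere (0 : E) 1)) := by
      have : Measurable fun p : E × E => ENNReal.ofReal (globalMaxwellian p.2) *
          ∫⁻ ω, G (p, ω) ∂(sphereMeasure : Measure (sphere (0 : E) 1)) :=
        (hM.comp measurable_snd).mul hGm.lintegral_prod_right'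
      exact this.lintegral_prod_right'
    rw [stdGaussian_eq_withDensity_globalMaxwellian_holds, lintegral_withDensity_eq_lintegral_mul _ hM hmeas2]
    refine lintegral_congr fun v => ?_
    simp only [Pi.mul_apply]
    rw [← lintegral_const_mul _ (show Measurable (fun w : E => ENNReal.ofReal (globalMaxwellian w) *
        ∫⁻ ω, G ((v, w), ω) ∂(sphereMeasure : Measure (sphere (0 : E) 1))) from
      (hM.mul (hGv v).lintegral_prod_right'))]
    refine lintegral_congr fun w => ?_
    rw [← mul_assoc, ← lintegral_const_mul _ (show Measurable (fun ω : sphere (0 : E) 1 => G ((v, w), ω)) from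
      (hGv v).comp measurable_prodMk_left)]
  -- Step 3: the three kernel-form bounds with `h = 1`
  have hsplit : ∀ q : (E × E) × sphere (0 : E) 1,
      ENNReal.ofReal (globalMaxwellian q.1.1) * ENNReal.ofReal (globalMaxwellian q.1.2) * G q =
      ‖collisionDensity q * ((fun _ : E => (1 : ℝ)) q.1.1 * g (gainVelFst q))‖ₑ +
        ‖collisionDensity q * ((fun _ : E => (1 : ℝ)) q.1.1 * g (gainVelSnd q))‖ₑ +
        ‖collisionDensity q * ((fun _ : E => (1 : ℝ)) q.1.1 * g (lossVel q))‖ₑ := by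
    intro q
    have hcd : ‖collisionDensity q‖ₑ = ENNReal.ofReal (hardSphereKernel q.1 q.2) *
        (ENNReal.ofReal (globalMaxwellian q.1.1) * ENNReal.ofReal (globalMaxwellian q.1.2)) := by
      rw [Real.enorm_eq_ofReal (collisionDensity_nonneg q), collisionDensity,
        ENNReal.ofReal_mul (show 0 ≤ hardSphereKernel q.1 q.2 from le_max_right _ _),
        ENNReal.ofReal_mul (globalMaxwellian_pos _).le]
    simp only [hG, enorm_mul, one_mul, hcd, gainVelFst_apply, gainVelSnd_apply, lossVel_apply]
    ring
  have hm1 : AEMeasurable (fun q : (E × E) × sphere (0 : E) 1 =>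
      ‖collisionDensity q * ((fun _ : E => (1 : ℝ)) q.1.1 * g (gainVelFst q))‖ₑ)
      (((volume : Measure E).prod volume).prod sphereMeasure) :=
    (continuous_collisionDensity.measurable.mul (measurable_const.mul
      (hgm.comp quasiMeasurePreserving_gainVelFst.measurable))).enorm.aemeasurable
  have hm2 : AEMeasurable (fun q : (E × E) × sphere (0 : E) 1 =>
      ‖collisionDensity q * ((fun _ : E => (1 : ℝ)) q.1.1 * g (gainVelSnd q))‖ₑ)
      (((volume : Measure E).prod volume).prod sphereMeasure) :=
    (continuous_collisionDensity.measurable.mul (measurable_const.mul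
      (hgm.comp quasiMeasurePreserving_gainVelSnd.measurable))).enorm.aemeasurable
  calc ∫⁻ v, ‖∫ w, ∫ ω, hardSphereKernel (v, w) ω *
        (g (collide ω (v, w)).1 + g (collide ω (v, w)).2 - g w) ∂sphereMeasure ∂stdGaussian E‖ₑ
        ∂stdGaussian E
      ≤ ∫⁻ v, ∫⁻ w, ∫⁻ ω, G ((v, w), ω) ∂sphereMeasure ∂stdGaussian E ∂stdGaussian E :=
        lintegral_mono hstep1
    _ = _ := hstep2
    _ = (∫⁻ q, ‖collisionDensity q * ((fun _ : E => (1 : ℝ)) q.1.1 * g (gainVelFst q))‖ₑ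
          ∂(((volume : Measure E).prod volume).prod sphereMeasure)) +
        (∫⁻ q, ‖collisionDensity q * ((fun _ : E => (1 : ℝ)) q.1.1 * g (gainVelSnd q))‖ₑ
          ∂(((volume : Measure E).prod volume).prod sphereMeasure)) +
        ∫⁻ q, ‖collisionDensity q * ((fun _ : E => (1 : ℝ)) q.1.1 * g (lossVel q))‖ₑ
          ∂(((volume : Measure E).prod volume).prod sphereMeasure) := by
        rw [lintegral_congr hsplit, lintegral_add_left' (show AEMeasurable (fun q : (E × E) × sphere (0 : E) 1 =>
            ‖collisionDensity q * ((fun _ : E => (1 : ℝ)) q.1.1 * g (gainVelFst q))‖ₑ +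
            ‖collisionDensity q * ((fun _ : E => (1 : ℝ)) q.1.1 * g (gainVelSnd q))‖ₑ) _ from hm1.add hm2),
          lintegral_add_left' hm1]
    _ ≤ gainFstRowConst E * eLpNorm (fun _ : E => (1 : ℝ)) 2 (stdGaussian E) * eLpNorm g 2 (stdGaussian E) +
        gainSndRowConst hE * eLpNorm (fun _ : E => (1 : ℝ)) 2 (stdGaussian E) * eLpNorm g 2 (stdGaussian E) +
        lossRowConst E * eLpNorm (fun _ : E => (1 : ℝ)) 2 (stdGaussian E) * eLpNorm g 2 (stdGaussian E) :=
        add_le_add (add_le_add (lintegral_enorm_kernelForm_gainVelFst_le h1 hg.1)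
          (lintegral_enorm_kernelForm_gainVelSnd_le hE h1 hg.1)) (lintegral_enorm_kernelForm_lossVel_le h1 hg.1)
    _ = _ := by rw [kernelConst]; ring

/-- **The kernel action of a measurable `g ∈ L²(M dv)` is `M dv`-integrable.** [folklore] -/
theorem integrable_kernelAction_of_memLp (hE : 2 ≤ finrank ℝ E) {g : E → ℝ}
    (hg : MemLp g 2 (stdGaussian E)) (hgm : Measurable g) :
    Integrable (fun v : E => ∫ w, ∫ ω, hardSphereKernel (v, w) ω *
      (g (collide ω (v, w)).1 + g (collide ω (v, w)).2 - g w) ∂sphereMeasure ∂stdGaussian E)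
      (stdGaussian E) := by
  refine ⟨(stronglyMeasurable_kernelAction_of_measurable hgm).aestronglyMeasurable, ?_⟩
  rw [hasFiniteIntegral_iff_enorm]
  refine lt_of_le_of_lt (lintegral_enorm_kernelAction_le hE hg hgm) ?_
  refine ENNReal.mul_lt_top (ENNReal.mul_lt_top (kernelConst_ne_top hE).lt_top ?_) hg.eLpNorm_lt_top
  exact (memLp_const (1 : ℝ)).eLpNorm_lt_top

/-! ### `K f` is given by the kernel integral almost everywhere, for every `f ∈ L²(M dv)` -/

/-- **`K` acts by its integral formula on all of `L²(M dv)`**: for every `f ∈ L²(M dv)`,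
`(K f)(v) = ∫∫ ((v - v_*)·ω)₊ (f(v') + f(v_*') - f(v_*)) dω dM(v_*)` for `M dv`-a.e. `v` (extends
`gainLossOp_toLp` from temperate-growth classes; test `⟪K f, 1_S⟫` against indicators and use
`linearizedKernelForm_eq_integral_of_memLp`). [folklore] -/
theorem coeFn_gainLossOp_ae_eq_kernelAction (hE : 2 ≤ finrank ℝ E) (f : Lp ℝ 2 (stdGaussian E)) :
    (gainLossOp hE f : E → ℝ) =ᵐ[stdGaussian E] fun v => ∫ w, ∫ ω, hardSphereKernel (v, w) ω *
      ((f : E → ℝ) (collide ω (v, w)).1 + (f : E → ℝ) (collide ω (v, w)).2 - (f : E → ℝ) w)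
        ∂sphereMeasure ∂stdGaussian E := by
  have hfm : Measurable (f : E → ℝ) := (Lp.stronglyMeasurable f).measurable
  have hKint : Integrable (gainLossOp hE f : E → ℝ) (stdGaussian E) :=
    (Lp.memLp (gainLossOp hE f)).integrable one_le_two
  refine Integrable.ae_eq_of_forall_setIntegral_eq _ _ hKint
    (integrable_kernelAction_of_memLp hE (Lp.memLp f) hfm) (fun S hS hμS => ?_)
  -- test against the indicator of `S`
  have hind : MemLp (S.indicator fun _ : E => (1 : ℝ)) 2 (stdGaussian E) :=
    memLp_indicator_const 2 hS 1 (Or.inr hμS.ne)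
  have h1 : ∫ v in S, (gainLossOp hE f : E → ℝ) v ∂stdGaussian E =
      ⟪indicatorConstLp 2 hS hμS.ne (1 : ℝ), gainLossOp hE f⟫_ℝ :=
    (L2.inner_indicatorConstLp_one hS hμS.ne (gainLossOp hE f)).symm
  rw [h1, real_inner_comm, inner_gainLossOp,
    linearizedKernelForm_congr_ae indicatorConstLp_coeFn EventuallyEq.rfl,
    linearizedKernelForm_eq_integral_of_memLp hE (Lp.memLp f) hind, ← integral_indicator hS]
  refine integral_congr_ae (Eventually.of_forall fun v => ?_)
  by_cases hv : v ∈ S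
  · simp [indicator_of_mem hv]
  · simp [indicator_of_notMem hv]

end

end Literature.Analysis.UnboundedOperators
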